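import Summits.HodgeConjecture.CorCM.OcticDecicWeilGRealised
import Summits.HodgeConjecture.CorCM.Census.OcticDecicWeil22Defect
import Summits.HodgeConjecture.CorCM.OcticWeilFourfoldHodgeOfMarkman
import HarnessLib

/-!
# COR-CM — `E × B₄ × B₅` with `B₄` of WEIL TYPE (`(2,2)`) over an octic and `B₅` a `(2,3)`-fivefold over a decic CM field sharing `k`, THROUGH THE
# MULTI-FIELD WEIL ENGINE: the type readings at `({0,1}, {0,1})` and the REALISED TUPLES — the realised decic rotation of gen 28 BY NAME and ORDERED
# `2`-TRANSITIVITY on the four octic pairs from `2`-transitivity of `Aut(ℂ/k)` on the embeddings of `K₂` over `τ`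

Cell `pub-hodgecm2` (COR-CM), seat b30 gen 29 (2026-08-24); count-neutral own lane (stem `OcticDecicWeil*`), sequel of `Census/OcticDecicWeil22Defect.lean` and of
gen 28ʼs `CorCM/OcticDecicWeilGRealised.lean`, whose frame family `e2`, embeddings `im2`, realised tuples `realised2`, readings `he2_sign`/`he2_conj` and realised
rotation `rot_stable_realisedTuples2` (`(π₂, σ)¹² = (1, σ²)`, NO Galois hypothesis) are reused BY NAME.  Theorems only; no definition, no named fact, no `sorry`.
* §1 `hΦ22` — the type readings of the family at the position sets `P22 = ({0,1}, {0,1})`;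
* §2 **`twoTransitive_realisedTuples2`** — the hypothesis `h2t` of `Census.OcticDecicWeil22.exists_hasDefectsG_of_modelBalancedG22` from the INTRINSIC
  `2`-transitivity `h2T` of `Aut(ℂ)` on the four embeddings of `K₂` over `τ` (gen 19ʼs `OcticWeilFourfold.h2t_of_twoTransitive`; Dodson: automatic when
  `B₄` is simple, `OcticWeilFourfold.twoTransitive_of_isSimple`), realised as a tuple by `MultiFieldWeil.exists_mem_realisedTuples_of_comp_tau_eq`;
* §3 **`exists_hasDefectsG_realisedTuples22`** — the hypothesis `hdef` of the generic headline for this instance.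
HONEST FRAMING: nothing about the Hodge conjecture is concluded here; `HC_CM` is not asserted.
[cite: Dodson1984, §3.3.2 Theorem] [cite: Shimura1998, §18.2 Lemma (i)] [cite: MoonenZarhin1995Duke, Thm. 2.4]

## References
* [Dodson1984] B. Dodson, Trans. AMS 283 (1984), §3.3.2 Theorem.  [Shimura1998] G. Shimura, *Abelian varieties with CM and modular functions*, §18.2
  Lemma (i).  [MoonenZarhin1995Duke] B. Moonen, Yu. Zarhin, Duke Math. J. 77 (1995), Thm. 2.4.
-/

noncomputable section

open CategoryTheory CategoryTheory.Limits NumberField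

namespace Summit.HodgeConjecture.CorCM.OcticDecicWeil22

open Literature.AlgebraicGeometry Literature.AlgebraicGeometry.Motives Literature.AlgebraicGeometry.HodgeTheory
open Literature.NumberTheory.ComplexMultiplication
open Summit.HodgeConjecture.CorCM.Census.MultiFieldWeil
open Summit.HodgeConjecture.CorCM.Census.OcticDecicWeilG (n2 oc2 dc2 withDc2)
open Summit.HodgeConjecture.CorCM.Census.OcticDecicWeil22
open Summit.HodgeConjecture.CorCM.MultiFieldWeil
open Summit.HodgeConjecture.CorCM.OcticDecicWeilG (e2 im2 realised2 he2_sign rot_stable_realisedTuples2)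
open Summit.HodgeConjecture.CorCM.OcticWeilFourfold (h2t_of_twoTransitive)

open scoped Classical

/-! ## §1 The type readings at `({0,1}, {0,1})` -/

section Frames

variable {I : Type} {Kf : I → Type} [∀ i, Field (Kf i)] {i₀ : I} {is : Fin 2 → I}
  {e₂ : (Kf (is 0) →+* ℂ) ≃ Fin 4 × Bool} {e₃ : (Kf (is 1) →+* ℂ) ≃ Fin 5 × Bool}
  {Φ : ∀ j : Fin (2 + 1), CMType (Kf (mfSlots i₀ is j))}

/-- The type readings of the family at `P22 = ({0,1}, {0,1})` from the two readings `Φ₂ ↔ {0,1} over τ`, `Φ₃ ↔ {0,1} over τ`. [folklore] -/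
theorem hΦ22 (hΦ₂ : ∀ s : Kf (is 0) →+* ℂ, s ∈ (Φ 1).1 ↔ (e₂ s).2 = decide ((e₂ s).1 = 0 ∨ (e₂ s).1 = 1))
    (hΦ₃ : ∀ s : Kf (is 1) →+* ℂ, s ∈ (Φ 2).1 ↔ (e₃ s).2 = decide ((e₃ s).1 = 0 ∨ (e₃ s).1 = 1)) :
    ∀ (m : Fin 2) (s : Kf (is m) →+* ℂ), s ∈ (Φ m.succ).1 ↔ (e2 is e₂ e₃ m s).2 = decide ((e2 is e₂ e₃ m s).1 ∈ P22 m) := by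
  have h0 : ∀ s : Kf (is 0) →+* ℂ, s ∈ (Φ 1).1 ↔ (e2 is e₂ e₃ 0 s).2 = decide ((e2 is e₂ e₃ 0 s).1 ∈ P22 0) := fun s => by
    refine (hΦ₂ s).trans ?_
    show (e₂ s).2 = decide ((e₂ s).1 = 0 ∨ (e₂ s).1 = 1) ↔ (e₂ s).2 = decide ((e₂ s).1 ∈ lowPos 4 2)
    have hd : decide ((e₂ s).1 ∈ lowPos 4 2) = decide ((e₂ s).1 = 0 ∨ (e₂ s).1 = 1) := decide_eq_decide.2 mem_lowPos_two
    rw [hd]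
  have h1 : ∀ s : Kf (is 1) →+* ℂ, s ∈ (Φ 2).1 ↔ (e2 is e₂ e₃ 1 s).2 = decide ((e2 is e₂ e₃ 1 s).1 ∈ P22 1) := fun s => by
    refine (hΦ₃ s).trans ?_
    show (e₃ s).2 = decide ((e₃ s).1 = 0 ∨ (e₃ s).1 = 1) ↔ (e₃ s).2 = decide ((e₃ s).1 ∈ lowPos 5 2)
    have hd : decide ((e₃ s).1 ∈ lowPos 5 2) = decide ((e₃ s).1 = 0 ∨ (e₃ s).1 = 1) := decide_eq_decide.2 mem_lowPos_two
    rw [hd]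
  intro m
  exact Fin.cases (motive := fun m => ∀ s : Kf (is m) →+* ℂ, s ∈ (Φ m.succ).1 ↔ (e2 is e₂ e₃ m s).2 = decide ((e2 is e₂ e₃ m s).1 ∈ P22 m))
    h0 (fun m => Fin.cases (motive := fun m : Fin 1 => ∀ s : Kf (is m.succ) →+* ℂ,
      s ∈ (Φ m.succ.succ).1 ↔ (e2 is e₂ e₃ m.succ s).2 = decide ((e2 is e₂ e₃ m.succ s).1 ∈ P22 m.succ)) h1 (fun m => m.elim0) m) m

end Frames

/-! ## §2 Ordered `2`-transitivity on the octic pairs, realised as tuples -/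

section Realised

variable {I : Type} {Kf : I → Type} [∀ i, Field (Kf i)] [∀ i, NumberField (Kf i)] {i₀ : I} {is : Fin 2 → I}
  {e₂ : (Kf (is 0) →+* ℂ) ≃ Fin 4 × Bool} {e₃ : (Kf (is 1) →+* ℂ) ≃ Fin 5 × Bool}
  {i₂ : Kf i₀ →+* Kf (is 0)} {i₃ : Kf i₀ →+* Kf (is 1)} {τ : Kf i₀ →+* ℂ}
  (he₂_sign : ∀ s, (e₂ s).2 = true ↔ s.comp i₂ = τ) (he₃_sign : ∀ s, (e₃ s).2 = true ↔ s.comp i₃ = τ)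

include he₂_sign he₃_sign in
omit [∀ i, NumberField (Kf i)] in
/-- **Every ORDERED pair of distinct octic pairs is moved to `(0, 1)` by a realised tuple** (`h2t`), from the intrinsic `2`-TRANSITIVITY `h2T` of `Aut(ℂ)` on
the four embeddings of `K₂` over `τ`: the automorphism carrying `(e₂⁻¹(x,+), e₂⁻¹(y,+))` to `(e₂⁻¹(0,+), e₂⁻¹(1,+))` fixes `τ` and induces a realised tuple.
[cite: Dodson1984, §3.3.2 Theorem] [cite: Shimura1998, §18.2 Lemma (i)] -/
theorem twoTransitive_realisedTuples2
    (h2T : ∀ s t s' t' : Kf (is 0) →+* ℂ, s.comp i₂ = τ → t.comp i₂ = τ → s'.comp i₂ = τ → t'.comp i₂ = τ → s ≠ t → s' ≠ t' →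
      ∃ ρ : ℂ ≃+* ℂ, (ρ : ℂ →+* ℂ).comp s = s' ∧ (ρ : ℂ →+* ℂ).comp t = t') :
    ∀ x y : Fin 4, x ≠ y → ∃ π ∈ realised2 is e₂ e₃ τ, oc2 π x = 0 ∧ oc2 π y = 1 := by
  intro x y hxy
  obtain ⟨ρ, hx, hy⟩ := h2t_of_twoTransitive he₂_sign h2T x y hxy
  have hρτ : (ρ : ℂ →+* ℂ).comp τ = τ := by
    have hx' : (e₂.symm (x, true)).comp i₂ = τ := (he₂_sign _).1 (by rw [Equiv.apply_symm_apply])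
    have h0 : (e₂.symm ((0 : Fin 4), true)).comp i₂ = τ := (he₂_sign _).1 (by rw [Equiv.apply_symm_apply])
    calc (ρ : ℂ →+* ℂ).comp τ = ((ρ : ℂ →+* ℂ).comp (e₂.symm (x, true))).comp i₂ := by rw [RingHom.comp_assoc, hx']
      _ = τ := by rw [hx, h0]
  obtain ⟨π, hπ, hπρ⟩ := exists_mem_realisedTuples_of_comp_tau_eq (is := is) (n := n2) (e := e2 is e₂ e₃)
    (he2_sign (is := is) he₂_sign he₃_sign) ρ hρτ
  refine ⟨π, hπ, ?_, ?_⟩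
  · have h := hπρ 0 x
    change (ρ : ℂ →+* ℂ).comp (e₂.symm (x, true)) = e₂.symm (oc2 π x, true) at h
    rw [hx] at h
    exact ((Prod.mk.inj (e₂.symm.injective h)).1).symm
  · have h := hπρ 0 y
    change (ρ : ℂ →+* ℂ).comp (e₂.symm (y, true)) = e₂.symm (oc2 π y, true) at h
    rw [hy] at h
    exact ((Prod.mk.inj (e₂.symm.injective h)).1).symm

/-! ## §3 The defect law for the realised tuples -/

include he₂_sign he₃_sign in
/-- **Every configuration balanced under the realised tuples of a `(2,2)`-octic and a `(2,3)`-decic slot through `k` obeys the defect law with curve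
multiplicities `(0, 1)`** — the hypothesis `hdef` of the generic headline — GIVEN `2`-transitivity of `Aut(ℂ)` on the embeddings of `K₂` over `τ` (and nothing on
`K₃`). [cite: MoonenZarhin1995Duke, Thm. 2.4] [cite: Dodson1984, §3.3.2 Theorem] -/
theorem exists_hasDefectsG_realisedTuples22
    (h2T : ∀ s t s' t' : Kf (is 0) →+* ℂ, s.comp i₂ = τ → t.comp i₂ = τ → s'.comp i₂ = τ → t'.comp i₂ = τ → s ≠ t → s' ≠ t' →
      ∃ ρ : ℂ ≃+* ℂ, (ρ : ℂ →+* ℂ).comp s = s' ∧ (ρ : ℂ →+* ℂ).comp t = t')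
    {α : Type} (v : α → PtG n2) (T : Finset α)
    (hT : ModelBalancedG P22 (realised2 is e₂ e₃ τ) v T) : ∃ t : Fin 2 → ℤ, HasDefectsG c22 v T t := by
  obtain ⟨g, hrot⟩ := rot_stable_realisedTuples2 he₂_sign he₃_sign
  exact exists_hasDefectsG_of_modelBalancedG22 g hrot (twoTransitive_realisedTuples2 he₂_sign he₃_sign h2T) hT

end Realised

end Summit.HodgeConjecture.CorCM.OcticDecicWeil22

end
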